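import Mathlib
import HarnessLib
import Summits.PneNP.PneNP.Theorems.RamseyUncertifiablePaleySosRungCrossNormAux1

/-!
# Cross-matrix norm bounds from star codegrees — auxiliary file 2/2 (the two term bounds)

Helper file for the registered stub `stub_crossNormOfCodegrees` of crux stmt-PneNP-9817
(`Summit.PneNP.PneNP.Theses.RamseyUncertifiable.PaleySosRung`, line `weil-patch-transfer`).

For `a`-sets `V` and `b`-sets `W` of a finite type of size `N` and weights `τ(V,w)`, the cross
matrix entry decomposes as `R[V,W] = Σ_{k=1}^{b} Σ_{W' ⊆ W, |W'| = k} T_k[V,W'] + E[V,W]` with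
`T_k[V,W'] = Π_{w ∈ W'} τ(V,w)` and `E[V,W] = [V ∩ W ≠ ∅]`. This file bounds the two kinds of
terms of the bilinear form `Σ u_V v_W R[V,W]`:

* `abs_termK_le`: `|uᵀ T_k N_k v| ≤ √(ρ ‖u‖²) · √(N^(b-k) 2^b ‖v‖²)` whenever the row sums of
  `|T_k T_kᵀ|` are at most `ρ` (Cauchy–Schwarz, then the Schur test);
* `abs_termE_le`: `|uᵀ E v| ≤ √(a N^(a-1) ‖u‖²) · √(b N^(b-1) ‖v‖²)`;
* `row_sum_le`: the row sums of `|T_k T_kᵀ|`, whose entries are elementary symmetric functions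
  `e_k(w ↦ τ(V,w) τ(V',w))`, are at most `N^a (K D)^k + a N^(a-1) (K N)^k` (`K = 1 + 4^r(2r+1)`)
  as soon as `|τ| ≤ 2^r` and the codegrees `Σ_{w ∉ V ∪ V'} τ(V,w)τ(V',w)` of DISJOINT pairs are
  at most `D` in modulus (`√N ≤ D ≤ N`), by the Newton bound of file 1;
* the elementary arithmetic of the constants (`const_bound_termK`, `const_bound_termE`).

All of this is folklore linear algebra; the matrices are those of Meka–Potechin–Wigderson,
*Sum-of-squares lower bounds for planted clique* (arXiv:1503.06447), §8.2.
-/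

set_option linter.dupNamespace false -- `Summit.PneNP.PneNP.…`: summit = sub-problem (D-0017)

namespace Summit.PneNP.PneNP.Theorems.PaleySosRungWeilPatch

namespace CrossNorm

open Finset

/-- **Constants, `k`-th term**: for `1 ≤ K`, `1 ≤ D ≤ N`, `1 ≤ a ≤ r`, `1 ≤ k ≤ b ≤ r`,
`(N^a (KD)^k + a N^(a-1) (KN)^k) · N^(b-k) 2^b ≤ 2^r K^r (r+1) · N^(a+b-1) D`. [folklore] -/
theorem const_bound_termK {N D K : ℝ} (hK : 1 ≤ K) (hD1 : 1 ≤ D) (hDN : D ≤ N)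
    {a b k r : ℕ} (ha1 : 1 ≤ a) (har : a ≤ r) (hbr : b ≤ r) (hk1 : 1 ≤ k) (hkb : k ≤ b) :
    (N ^ a * (K * D) ^ k + a * N ^ (a - 1) * (K * N) ^ k) * (N ^ (b - k) * 2 ^ b)
      ≤ 2 ^ r * K ^ r * (r + 1) * N ^ (a + b - 1) * D := by
  have hD0 : 0 ≤ D := zero_le_one.trans hD1
  have hN0 : 0 ≤ N := hD0.trans hDN
  have hK0 : 0 ≤ K := zero_le_one.trans hK
  obtain ⟨a₀, rfl⟩ : ∃ a₀, a = a₀ + 1 := ⟨a - 1, by omega⟩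
  obtain ⟨k₀, rfl⟩ : ∃ k₀, k = k₀ + 1 := ⟨k - 1, by omega⟩
  obtain ⟨c, rfl⟩ : ∃ c, b = k₀ + 1 + c := ⟨b - (k₀ + 1), by omega⟩
  have e1 : a₀ + 1 - 1 = a₀ := by omega
  have e2 : k₀ + 1 + c - (k₀ + 1) = c := by omega
  have e3 : a₀ + 1 + (k₀ + 1 + c) - 1 = a₀ + 1 + k₀ + c := by omega
  rw [e1, e2, e3]
  set P : ℝ := 2 ^ (k₀ + 1 + c) * K ^ (k₀ + 1) * N ^ (a₀ + 1 + k₀ + c) * D with hP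
  have hQ0 : 0 ≤ 2 ^ (k₀ + 1 + c) * K ^ (k₀ + 1) * N ^ (a₀ + 1 + k₀ + c) :=
    mul_nonneg (mul_nonneg (pow_nonneg zero_le_two _) (pow_nonneg hK0 _)) (pow_nonneg hN0 _)
  have h1 : N ^ (a₀ + 1) * (K * D) ^ (k₀ + 1) * (N ^ c * 2 ^ (k₀ + 1 + c)) ≤ P := by
    have hDk : D ^ k₀ ≤ N ^ k₀ := pow_le_pow_left₀ hD0 hDN k₀
    calc N ^ (a₀ + 1) * (K * D) ^ (k₀ + 1) * (N ^ c * 2 ^ (k₀ + 1 + c))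
        = (2 ^ (k₀ + 1 + c) * K ^ (k₀ + 1) * N ^ (a₀ + 1) * N ^ c * D) * D ^ k₀ := by ring
      _ ≤ (2 ^ (k₀ + 1 + c) * K ^ (k₀ + 1) * N ^ (a₀ + 1) * N ^ c * D) * N ^ k₀ := by
          refine mul_le_mul_of_nonneg_left hDk ?_
          exact mul_nonneg (mul_nonneg (mul_nonneg (mul_nonneg (pow_nonneg zero_le_two _)
            (pow_nonneg hK0 _)) (pow_nonneg hN0 _)) (pow_nonneg hN0 _)) hD0
      _ = P := by rw [hP]; ring
  have h2 : ((a₀ + 1 : ℕ) : ℝ) * N ^ a₀ * (K * N) ^ (k₀ + 1) * (N ^ c * 2 ^ (k₀ + 1 + c))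
      ≤ ((a₀ + 1 : ℕ) : ℝ) * P := by
    calc ((a₀ + 1 : ℕ) : ℝ) * N ^ a₀ * (K * N) ^ (k₀ + 1) * (N ^ c * 2 ^ (k₀ + 1 + c))
        = ((a₀ + 1 : ℕ) : ℝ) * (2 ^ (k₀ + 1 + c) * K ^ (k₀ + 1) * N ^ (a₀ + 1 + k₀ + c)) * 1 := by
          ring
      _ ≤ ((a₀ + 1 : ℕ) : ℝ) * (2 ^ (k₀ + 1 + c) * K ^ (k₀ + 1) * N ^ (a₀ + 1 + k₀ + c)) * D :=
          mul_le_mul_of_nonneg_left hD1 (mul_nonneg (Nat.cast_nonneg _) hQ0)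
      _ = ((a₀ + 1 : ℕ) : ℝ) * P := by rw [hP]; ring
  have h3 : (((a₀ + 1 : ℕ) : ℝ) + 1) * P
      ≤ 2 ^ r * K ^ r * (r + 1) * N ^ (a₀ + 1 + k₀ + c) * D := by
    have i1 : ((a₀ + 1 : ℕ) : ℝ) + 1 ≤ r + 1 := by
      have : ((a₀ + 1 : ℕ) : ℝ) ≤ r := by exact_mod_cast har
      linarith
    have i2 : (2 : ℝ) ^ (k₀ + 1 + c) ≤ 2 ^ r := pow_le_pow_right₀ one_le_two hbr
    have i3 : K ^ (k₀ + 1) ≤ K ^ r := pow_le_pow_right₀ hK (by omega)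
    have hND : 0 ≤ N ^ (a₀ + 1 + k₀ + c) * D := mul_nonneg (pow_nonneg hN0 _) hD0
    calc (((a₀ + 1 : ℕ) : ℝ) + 1) * P
        = (((a₀ + 1 : ℕ) : ℝ) + 1) * 2 ^ (k₀ + 1 + c) * K ^ (k₀ + 1)
            * (N ^ (a₀ + 1 + k₀ + c) * D) := by rw [hP]; ring
      _ ≤ ((r : ℝ) + 1) * 2 ^ r * K ^ r * (N ^ (a₀ + 1 + k₀ + c) * D) := by
          refine mul_le_mul_of_nonneg_right ?_ hND
          refine mul_le_mul (mul_le_mul i1 i2 (by positivity) (by positivity)) i3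
            (pow_nonneg hK0 _) (by positivity)
      _ = 2 ^ r * K ^ r * (r + 1) * N ^ (a₀ + 1 + k₀ + c) * D := by ring
  calc (N ^ (a₀ + 1) * (K * D) ^ (k₀ + 1) + ((a₀ + 1 : ℕ) : ℝ) * N ^ a₀ * (K * N) ^ (k₀ + 1))
        * (N ^ c * 2 ^ (k₀ + 1 + c))
      = N ^ (a₀ + 1) * (K * D) ^ (k₀ + 1) * (N ^ c * 2 ^ (k₀ + 1 + c))
        + ((a₀ + 1 : ℕ) : ℝ) * N ^ a₀ * (K * N) ^ (k₀ + 1) * (N ^ c * 2 ^ (k₀ + 1 + c)) := by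
          ring
    _ ≤ P + ((a₀ + 1 : ℕ) : ℝ) * P := add_le_add h1 h2
    _ = (((a₀ + 1 : ℕ) : ℝ) + 1) * P := by ring
    _ ≤ _ := h3

/-- **Constants, `E` term**: for `1 ≤ K`, `1 ≤ D ≤ N`, `1 ≤ a ≤ r`, `1 ≤ b ≤ r`,
`(a N^(a-1)) · (b N^(b-1)) ≤ 2^r K^r (r+1) · N^(a+b-1) D`. [folklore] -/
theorem const_bound_termE {N D K : ℝ} (hK : 1 ≤ K) (hD1 : 1 ≤ D) (hDN : D ≤ N)
    {a b r : ℕ} (ha1 : 1 ≤ a) (har : a ≤ r) (hb1 : 1 ≤ b) (hbr : b ≤ r) :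
    (a * N ^ (a - 1)) * (b * N ^ (b - 1)) ≤ 2 ^ r * K ^ r * (r + 1) * N ^ (a + b - 1) * D := by
  have hD0 : 0 ≤ D := zero_le_one.trans hD1
  have hN0 : 0 ≤ N := hD0.trans hDN
  have hN1 : 1 ≤ N := hD1.trans hDN
  have hK0 : 0 ≤ K := zero_le_one.trans hK
  obtain ⟨a₀, rfl⟩ : ∃ a₀, a = a₀ + 1 := ⟨a - 1, by omega⟩
  obtain ⟨b₀, rfl⟩ : ∃ b₀, b = b₀ + 1 := ⟨b - 1, by omega⟩
  have e1 : a₀ + 1 - 1 = a₀ := by omega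
  have e2 : b₀ + 1 - 1 = b₀ := by omega
  have e3 : a₀ + 1 + (b₀ + 1) - 1 = a₀ + b₀ + 1 := by omega
  rw [e1, e2, e3]
  have i1 : ((a₀ + 1 : ℕ) : ℝ) ≤ r + 1 := by
    have : ((a₀ + 1 : ℕ) : ℝ) ≤ r := by exact_mod_cast har
    linarith
  have i2 : ((b₀ + 1 : ℕ) : ℝ) ≤ 2 ^ r := by
    have h := Nat.lt_two_pow_self (n := r)
    have : ((b₀ + 1 : ℕ) : ℝ) ≤ r := by exact_mod_cast hbr
    have : (r : ℝ) ≤ 2 ^ r := by exact_mod_cast h.le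
    linarith
  have i3 : (1 : ℝ) ≤ K ^ r := one_le_pow₀ hK
  have i4 : N ^ a₀ * N ^ b₀ ≤ N ^ (a₀ + b₀ + 1) * D := by
    rw [← pow_add, pow_succ]
    calc N ^ (a₀ + b₀) = N ^ (a₀ + b₀) * 1 * 1 := by ring
      _ ≤ N ^ (a₀ + b₀) * N * D :=
          mul_le_mul (mul_le_mul_of_nonneg_left hN1 (pow_nonneg hN0 _)) hD1 zero_le_one
            (mul_nonneg (pow_nonneg hN0 _) hN0)
  calc ((a₀ + 1 : ℕ) : ℝ) * N ^ a₀ * (((b₀ + 1 : ℕ) : ℝ) * N ^ b₀)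
      = ((b₀ + 1 : ℕ) : ℝ) * 1 * ((a₀ + 1 : ℕ) : ℝ) * (N ^ a₀ * N ^ b₀) := by ring
    _ ≤ 2 ^ r * K ^ r * (r + 1) * (N ^ (a₀ + b₀ + 1) * D) := by
        refine mul_le_mul (mul_le_mul (mul_le_mul i2 i3 zero_le_one (by positivity)) i1
          (by positivity) (by positivity)) i4 (by positivity) (by positivity)
    _ = 2 ^ r * K ^ r * (r + 1) * N ^ (a₀ + b₀ + 1) * D := by ring

section Terms

variable {α : Type*} [Fintype α] [DecidableEq α]

/-- **The `k`-th term.** If the row sums `Σ_{V'} |Σ_{W'} T(V,W') T(V',W')|` over `a`-sets are at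
most `ρ`, then `|Σ_V Σ_W u_V v_W Σ_{W' ⊆ W, |W'| = k} T(V,W')| ≤ √(ρ ‖u‖²) √(N^(b-k) 2^b ‖v‖²)`:
factor through `z(W') = Σ_{W ⊇ W'} v_W`, Cauchy–Schwarz in `W'`, the Schur test for `‖Tᵀu‖²`
and `norm_sq_superset_sum_le` for `‖z‖²`. [folklore] -/
theorem abs_termK_le (sA : Finset (Finset α)) (b k : ℕ) (T : Finset α → Finset α → ℝ)
    (u v : Finset α → ℝ) {ρ : ℝ}
    (hrow : ∀ V ∈ sA, ∑ V' ∈ sA,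
      |∑ W' ∈ powersetCard k (univ : Finset α), T V W' * T V' W'| ≤ ρ) :
    |∑ V ∈ sA, ∑ W ∈ powersetCard b (univ : Finset α),
        u V * v W * ∑ W' ∈ powersetCard k W, T V W'|
      ≤ Real.sqrt (ρ * ∑ V ∈ sA, u V ^ 2)
        * Real.sqrt ((Fintype.card α : ℝ) ^ (b - k) * (2 : ℝ) ^ b
            * ∑ W ∈ powersetCard b (univ : Finset α), v W ^ 2) := by
  set z : Finset α → ℝ := fun W' =>
    ∑ W ∈ (powersetCard b (univ : Finset α)).filter (fun W => W' ⊆ W), v W with hz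
  -- factor through `z`
  have hb : ∑ V ∈ sA, ∑ W ∈ powersetCard b (univ : Finset α),
        u V * v W * ∑ W' ∈ powersetCard k W, T V W'
      = ∑ W' ∈ powersetCard k (univ : Finset α), z W' * ∑ V ∈ sA, u V * T V W' := by
    have h1 : ∀ V ∈ sA, ∑ W ∈ powersetCard b (univ : Finset α),
          u V * v W * ∑ W' ∈ powersetCard k W, T V W'
        = ∑ W' ∈ powersetCard k (univ : Finset α), u V * (T V W' * z W') := by
      intro V _
      simp_rw [mul_assoc]
      rw [← mul_sum, ← mul_sum, sum_mul_sum_powersetCard_eq]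
    rw [sum_congr rfl h1, sum_comm]
    refine sum_congr rfl fun W' _ => ?_
    rw [mul_sum]
    refine sum_congr rfl fun V _ => ?_
    ring
  rw [hb]
  -- Cauchy–Schwarz in `W'`
  refine (abs_sum_mul_le_sqrt_mul_sqrt _ _ _).trans ?_
  rw [mul_comm]
  refine mul_le_mul (Real.sqrt_le_sqrt ?_) (Real.sqrt_le_sqrt ?_) (Real.sqrt_nonneg _)
    (Real.sqrt_nonneg _)
  · -- Schur test
    rw [sum_sq_sum_mul_eq]
    refine (le_abs_self _).trans (abs_sum_sum_mul_mul_le sA _ u hrow fun V' hV' => ?_)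
    have hsym : ∀ V ∈ sA, |∑ W' ∈ powersetCard k (univ : Finset α), T V W' * T V' W'|
        = |∑ W' ∈ powersetCard k (univ : Finset α), T V' W' * T V W'| := by
      intro V _
      simp_rw [mul_comm (T V _)]
    rw [sum_congr rfl hsym]
    exact hrow V' hV'
  · exact norm_sq_superset_sum_le b k v

/-- `Σ_x (Σ_{V ∋ x} |u_V|)² ≤ a N^(a-1) ‖u‖²` over `a`-sets `V` (Cauchy–Schwarz in `V`, then
double counting `Σ_x Σ_{V ∋ x} u_V² = a ‖u‖²`). [folklore] -/
theorem sum_sq_sum_filter_mem_le (a : ℕ) (u : Finset α → ℝ) :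
    ∑ x : α, (∑ V ∈ (powersetCard a (univ : Finset α)).filter (fun V => x ∈ V), |u V|) ^ 2
      ≤ (a : ℝ) * (Fintype.card α : ℝ) ^ (a - 1)
          * ∑ V ∈ powersetCard a (univ : Finset α), u V ^ 2 := by
  set N : ℝ := (Fintype.card α : ℝ) with hN
  calc ∑ x : α, (∑ V ∈ (powersetCard a (univ : Finset α)).filter (fun V => x ∈ V), |u V|) ^ 2
      ≤ ∑ x : α, N ^ (a - 1)
          * ∑ V ∈ (powersetCard a (univ : Finset α)).filter (fun V => x ∈ V), |u V| ^ 2 := by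
        refine sum_le_sum fun x _ => (sq_sum_le_card_mul_sum_sq).trans ?_
        exact mul_le_mul_of_nonneg_right (card_filter_mem_le a x)
          (sum_nonneg fun _ _ => sq_nonneg _)
    _ = N ^ (a - 1) * ∑ V ∈ powersetCard a (univ : Finset α), (V.card : ℝ) * u V ^ 2 := by
        rw [← mul_sum]
        congr 1
        simp_rw [sum_filter, sq_abs]
        rw [sum_comm]
        refine sum_congr rfl fun V _ => ?_
        rw [← sum_filter, sum_const, nsmul_eq_mul, filter_mem_eq_inter, univ_inter]
    _ = (a : ℝ) * N ^ (a - 1) * ∑ V ∈ powersetCard a (univ : Finset α), u V ^ 2 := by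
        rw [mul_comm (a : ℝ), mul_assoc, mul_sum (powersetCard a univ) _ (a : ℝ)]
        congr 1
        refine sum_congr rfl fun V hV => ?_
        rw [(mem_powersetCard_univ.1 hV)]

/-- **The `E` term**: `|Σ_V Σ_W u_V v_W [V ∩ W ≠ ∅]| ≤ √(a N^(a-1) ‖u‖²) √(b N^(b-1) ‖v‖²)`, via
`[V ∩ W ≠ ∅] ≤ Σ_x [x ∈ V][x ∈ W]` and Cauchy–Schwarz in `x`. [folklore] -/
theorem abs_termE_le (a b : ℕ) (u v : Finset α → ℝ) :
    |∑ V ∈ powersetCard a (univ : Finset α), ∑ W ∈ powersetCard b (univ : Finset α),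
        u V * v W * (if Disjoint V W then 0 else 1)|
      ≤ Real.sqrt ((a : ℝ) * (Fintype.card α : ℝ) ^ (a - 1)
            * ∑ V ∈ powersetCard a (univ : Finset α), u V ^ 2)
        * Real.sqrt ((b : ℝ) * (Fintype.card α : ℝ) ^ (b - 1)
            * ∑ W ∈ powersetCard b (univ : Finset α), v W ^ 2) := by
  set sA := powersetCard a (univ : Finset α) with hsA
  set sB := powersetCard b (univ : Finset α) with hsB
  set F : α → ℝ := fun x => ∑ V ∈ sA.filter (fun V => x ∈ V), |u V| with hF
  set G' : α → ℝ := fun x => ∑ W ∈ sB.filter (fun W => x ∈ W), |v W| with hG'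
  have hind : ∀ V W : Finset α, (if Disjoint V W then (0 : ℝ) else 1)
      ≤ ∑ x : α, (if x ∈ V then (1 : ℝ) else 0) * (if x ∈ W then 1 else 0) := by
    intro V W
    split_ifs with hD
    · exact sum_nonneg fun x _ => by positivity
    · obtain ⟨z, hzV, hzW⟩ := not_disjoint_iff.1 hD
      refine le_trans ?_ (single_le_sum (f := fun x => (if x ∈ V then (1 : ℝ) else 0)
        * (if x ∈ W then 1 else 0)) (fun x _ => by positivity) (mem_univ z))
      simp [hzV, hzW]
  have h1 : |∑ V ∈ sA, ∑ W ∈ sB, u V * v W * (if Disjoint V W then 0 else 1)|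
      ≤ ∑ V ∈ sA, ∑ W ∈ sB, |u V| * |v W|
          * ∑ x : α, (if x ∈ V then (1 : ℝ) else 0) * (if x ∈ W then 1 else 0) := by
    refine (abs_sum_le_sum_abs _ _).trans (sum_le_sum fun V _ => ?_)
    refine (abs_sum_le_sum_abs _ _).trans (sum_le_sum fun W _ => ?_)
    rw [abs_mul, abs_mul]
    refine mul_le_mul_of_nonneg_left ?_ (by positivity)
    refine (abs_of_nonneg (by positivity)).le.trans (hind V W)
  have h2 : ∑ V ∈ sA, ∑ W ∈ sB, |u V| * |v W|
          * ∑ x : α, (if x ∈ V then (1 : ℝ) else 0) * (if x ∈ W then 1 else 0)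
      = ∑ x : α, F x * G' x := by
    have h3 : ∀ x : α, F x * G' x = ∑ V ∈ sA, ∑ W ∈ sB,
        (|u V| * (if x ∈ V then (1 : ℝ) else 0)) * (|v W| * (if x ∈ W then 1 else 0)) := by
      intro x
      simp only [hF, hG', sum_filter, sum_mul_sum]
      refine sum_congr rfl fun V _ => sum_congr rfl fun W _ => ?_
      split_ifs <;> ring
    simp_rw [h3, mul_sum]
    rw [sum_comm (s := (univ : Finset α))]
    refine sum_congr rfl fun V _ => ?_
    rw [sum_comm (s := (univ : Finset α))]
    refine sum_congr rfl fun W _ => sum_congr rfl fun x _ => by ring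
  refine h1.trans ?_
  rw [h2]
  refine (le_abs_self _).trans ((abs_sum_mul_le_sqrt_mul_sqrt _ _ _).trans ?_)
  refine mul_le_mul (Real.sqrt_le_sqrt ?_) (Real.sqrt_le_sqrt ?_) (Real.sqrt_nonneg _)
    (Real.sqrt_nonneg _)
  · exact sum_sq_sum_filter_mem_le a u
  · exact sum_sq_sum_filter_mem_le b v

/-- **Row sums of `T_k T_kᵀ`.** For weights `|τ(V,w)| ≤ 2^r`, a threshold `1 ≤ D` with
`√N ≤ D ≤ N`, and codegrees `|Σ_{w ∉ V ∪ V'} τ(V,w) τ(V',w)| ≤ D` for all DISJOINT pairs of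
`a`-sets (`a ≤ r`), every `a`-set `V` has
`Σ_{V'} |Σ_{|W'| = k} Π_{W'} τ(V,·) Π_{W'} τ(V',·)| ≤ N^a (K D)^k + a N^(a-1) (K N)^k`,
`K = 1 + 4^r (2r+1)`: each entry is `e_k` of the family `w ↦ τ(V,w)τ(V',w)` (moduli `≤ 4^r`), whose
sum is `≤ D + 2a·4^r` for the at most `N^a` disjoint `V'` and `≤ 4^r N` for the at most
`a N^(a-1)` sets `V'` meeting `V`; conclude by the Newton bound. [folklore] -/
theorem row_sum_le (τ : Finset α → α → ℝ) (a k r : ℕ) (har : a ≤ r)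
    (hτ : ∀ V w, |τ V w| ≤ (2 : ℝ) ^ r) {D : ℝ} (hD1 : 1 ≤ D)
    (hDN : D ≤ Fintype.card α) (hsqrt : Real.sqrt (Fintype.card α) ≤ D)
    (hyp : ∀ V ∈ powersetCard a (univ : Finset α), ∀ V' ∈ powersetCard a (univ : Finset α),
      Disjoint V V' → |∑ w ∈ univ \ (V ∪ V'), τ V w * τ V' w| ≤ D)
    (V : Finset α) (hV : V ∈ powersetCard a (univ : Finset α)) :
    ∑ V' ∈ powersetCard a (univ : Finset α),
        |∑ W' ∈ powersetCard k (univ : Finset α), (∏ w ∈ W', τ V w) * (∏ w ∈ W', τ V' w)|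
      ≤ (Fintype.card α : ℝ) ^ a * ((1 + (4 : ℝ) ^ r * (2 * r + 1)) * D) ^ k
        + a * (Fintype.card α : ℝ) ^ (a - 1)
          * ((1 + (4 : ℝ) ^ r * (2 * r + 1)) * Fintype.card α) ^ k := by
  set N : ℝ := (Fintype.card α : ℝ) with hN
  set K : ℝ := 1 + (4 : ℝ) ^ r * (2 * r + 1) with hK
  set sA := powersetCard a (univ : Finset α) with hsA
  have hD0 : 0 ≤ D := zero_le_one.trans hD1
  have h4 : (0 : ℝ) ≤ (4 : ℝ) ^ r := by positivity
  have hVa : V.card = a := mem_powersetCard_univ.1 hV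
  -- entries of `φ = τ V · τ V'` are bounded by `4^r`
  have hφ : ∀ V' : Finset α, ∀ w, |τ V w * τ V' w| ≤ (4 : ℝ) ^ r := by
    intro V' w
    rw [abs_mul, show (4 : ℝ) ^ r = 2 ^ r * 2 ^ r by rw [← mul_pow]; norm_num]
    exact mul_le_mul (hτ V w) (hτ V' w) (abs_nonneg _) (by positivity)
  -- each entry is an elementary symmetric function of `φ`
  have hM : ∀ V' : Finset α,
      ∑ W' ∈ powersetCard k (univ : Finset α), (∏ w ∈ W', τ V w) * (∏ w ∈ W', τ V' w)
        = ∑ W' ∈ powersetCard k (univ : Finset α), ∏ w ∈ W', (τ V w * τ V' w) := by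
    intro V'
    simp_rw [prod_mul_distrib]
  -- the bound for the pairs meeting `V` (no hypothesis needed)
  have hgen : ∀ V' : Finset α,
      |∑ W' ∈ powersetCard k (univ : Finset α), (∏ w ∈ W', τ V w) * (∏ w ∈ W', τ V' w)|
        ≤ (K * N) ^ k := by
    intro V'
    rw [hM]
    have hN1 : Real.sqrt N ≤ N := hsqrt.trans hDN
    refine abs_sum_powersetCard_prod_le _ h4 (hφ V') ?_ ?_ k
    · calc |∑ w, τ V w * τ V' w| ≤ ∑ w, |τ V w * τ V' w| := abs_sum_le_sum_abs _ _
        _ ≤ ∑ _w : α, (4 : ℝ) ^ r := sum_le_sum fun w _ => hφ V' w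
        _ = N * (4 : ℝ) ^ r := by rw [sum_const, card_univ, nsmul_eq_mul]
        _ ≤ K * N := by
            rw [mul_comm]
            refine mul_le_mul_of_nonneg_right ?_ (by positivity)
            rw [hK]
            nlinarith
    · calc (4 : ℝ) ^ r * Real.sqrt N ≤ (4 : ℝ) ^ r * N := mul_le_mul_of_nonneg_left hN1 h4
        _ ≤ K * N := by
            refine mul_le_mul_of_nonneg_right ?_ (by positivity)
            rw [hK]
            nlinarith
  -- the bound for the pairs disjoint from `V` (from the hypothesis)
  have hdis : ∀ V' ∈ sA, Disjoint V V' →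
      |∑ W' ∈ powersetCard k (univ : Finset α), (∏ w ∈ W', τ V w) * (∏ w ∈ W', τ V' w)|
        ≤ (K * D) ^ k := by
    intro V' hV' hdj
    rw [hM]
    have hV'a : V'.card = a := mem_powersetCard_univ.1 hV'
    refine abs_sum_powersetCard_prod_le _ h4 (hφ V') ?_ ?_ k
    · have hsplit := sum_sdiff (subset_univ (V ∪ V')) (f := fun w => τ V w * τ V' w)
      rw [← hsplit]
      refine (abs_add_le _ _).trans ?_
      have h1 := hyp V hV V' hV' hdj
      have h2 : |∑ w ∈ V ∪ V', τ V w * τ V' w| ≤ 2 * r * (4 : ℝ) ^ r := by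
        refine (abs_sum_le_sum_abs _ _).trans ?_
        refine (sum_le_card_nsmul _ _ _ fun w _ => hφ V' w).trans ?_
        rw [nsmul_eq_mul]
        refine mul_le_mul_of_nonneg_right ?_ h4
        calc ((V ∪ V').card : ℝ) ≤ (V.card + V'.card : ℕ) := by
              exact_mod_cast card_union_le V V'
          _ = 2 * a := by rw [hVa, hV'a]; push_cast; ring
          _ ≤ 2 * r := by exact_mod_cast Nat.mul_le_mul_left 2 har
      calc |∑ w ∈ univ \ (V ∪ V'), τ V w * τ V' w| + |∑ w ∈ V ∪ V', τ V w * τ V' w|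
          ≤ D + 2 * r * (4 : ℝ) ^ r := add_le_add h1 h2
        _ ≤ D + 2 * r * (4 : ℝ) ^ r * D := by
            have h0 : (0 : ℝ) ≤ 2 * r * (4 : ℝ) ^ r := by positivity
            nlinarith [mul_nonneg h0 (sub_nonneg.2 hD1)]
        _ ≤ K * D := by rw [hK]; nlinarith
    · calc (4 : ℝ) ^ r * Real.sqrt N ≤ (4 : ℝ) ^ r * D := mul_le_mul_of_nonneg_left hsqrt h4
        _ ≤ K * D := by
            refine mul_le_mul_of_nonneg_right ?_ hD0
            rw [hK]
            nlinarith
  -- split the row into the two kinds of pairs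
  rw [← sum_filter_add_sum_filter_not sA (fun V' => Disjoint V V')]
  refine add_le_add ?_ ?_
  · refine (sum_le_card_nsmul _ _ ((K * D) ^ k) fun V' hV' => ?_).trans ?_
    · rw [mem_filter] at hV'
      exact hdis V' hV'.1 hV'.2
    · rw [nsmul_eq_mul]
      refine mul_le_mul_of_nonneg_right ?_ (by positivity)
      calc (((sA.filter fun V' => Disjoint V V')).card : ℝ) ≤ sA.card := by
            exact_mod_cast card_filter_le _ _
        _ = (Fintype.card α).choose a := by rw [hsA, card_powersetCard, card_univ]
        _ ≤ N ^ a := by rw [hN]; exact_mod_cast Nat.choose_le_pow _ _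
  · refine (sum_le_card_nsmul _ _ _ fun V' _ => hgen V').trans ?_
    rw [nsmul_eq_mul]
    refine mul_le_mul_of_nonneg_right ?_ (by positivity)
    have := card_filter_not_disjoint_le a V
    rw [hVa] at this
    exact this

end Terms

end CrossNorm

/-- **Registered helper stub `cn_rowSumBound`** (sub-goal of `stub_crossNormOfCodegrees` on
stmt-PneNP-9817): the row-sum bound for `T_k T_kᵀ` from disjoint codegrees — a restatement of
`CrossNorm.row_sum_le`. [folklore] -/
theorem cn_rowSumBound : ∀ {α : Type*} [Fintype α] [DecidableEq α] (τ : Finset α → α → ℝ)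
    (a k r : ℕ), a ≤ r → (∀ V w, |τ V w| ≤ (2 : ℝ) ^ r) → ∀ (D : ℝ), 1 ≤ D →
    D ≤ Fintype.card α → Real.sqrt (Fintype.card α) ≤ D →
    (∀ V ∈ Finset.powersetCard a (Finset.univ : Finset α),
      ∀ V' ∈ Finset.powersetCard a (Finset.univ : Finset α), Disjoint V V' →
        |∑ w ∈ Finset.univ \ (V ∪ V'), τ V w * τ V' w| ≤ D) →
    ∀ V ∈ Finset.powersetCard a (Finset.univ : Finset α),
      ∑ V' ∈ Finset.powersetCard a (Finset.univ : Finset α),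
        |∑ W' ∈ Finset.powersetCard k (Finset.univ : Finset α),
          (∏ w ∈ W', τ V w) * (∏ w ∈ W', τ V' w)|
        ≤ (Fintype.card α : ℝ) ^ a * ((1 + (4 : ℝ) ^ r * (2 * r + 1)) * D) ^ k
          + a * (Fintype.card α : ℝ) ^ (a - 1)
            * ((1 + (4 : ℝ) ^ r * (2 * r + 1)) * Fintype.card α) ^ k :=
  fun τ a k r har hτ _ hD1 hDN hsqrt hyp V hV =>
    CrossNorm.row_sum_le τ a k r har hτ hD1 hDN hsqrt hyp V hV

end Summit.PneNP.PneNP.Theorems.PaleySosRungWeilPatch
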